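import Summits.QuantumFields.YangMills.Theorems.LuscherReductionTwistedTraceScalingFibreMassBrick
import Summits.QuantumFields.YangMills.Theorems.LuscherReductionTwistedTraceScalingSlicePointFat
import Summits.QuantumFields.YangMills.Theorems.LuscherReductionRunningReductionLatticeTopLower
import Summits.QuantumFields.YangMills.Theorems.LuscherReductionRunningReductionCombGaugeBox
import HarnessLib

/-!
# Support geometry of Born–Oppenheimer functions: fibres over a slow window lie in the fat tube (`BOBricks.hbo`, `BOBricks.htube`, the fibre hypothesis of (B-N))
# (lane A of S-BASE, crux `TwistedTraceScaling` stmt-QuantumFields-20203, C4 INNER; design note `pub/ym-fleet/ym-luscher-20007-p1/COARSE-DESIGN.md` §24.7)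

Elementary geometry of the orthographic tube map `orthoTube u v` (links `chartSU2(v_e)·u_{dir e}`):
* `orbitDist_one_site_eq` — on ONE site the orbit distance is `Σ_e ‖u_e − 1‖_F` (gauge transformations act by a single conjugation);
* `frobNorm_orthoTube_sub_one_le` — `‖(orthoTube u v)_e − 1‖_F ≤ 4‖v_e‖ + ‖u_{dir e} − 1‖_F` (`‖v_e‖ ≤ 1/2`);
* `norm_apply_le_norm_linkEmbed` — `‖v_e‖ ≤ ‖linkEmbed v‖`;
* ★ `orthoTube_mem_nearOne`, ★ `orbitDist_orthoTube_le` — a fibre point over a slow `u` with `orbitDist₁ u < δ₁` through `‖v_e‖ ≤ r` has all links within `4r + δ₁` of `1` and orbit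
  distance `≤ |Edge|·(4r + δ₁)`;
* ★★ `orthoTube_mem_fatTubeRho` (the fibre hypothesis of `fibreMass_brick_record`) and ★★ `boFun_support_record` (`BOBricks.hbo` for the record weight): BO functions with
  amplitude in `{orbitDist₁ < δ₁}` and profile supported in `{‖x‖ ≤ r}` live in `supp (recordWeightRho δ' ρ δg β) ∩ {orbitDist < |Edge|(4r+δ₁)}` once `4r + δ₁ < ρ β` and
  `|Edge|(4r + δ₁) < δ' β`.
HONEST FRAMING: structural fields of the typed brick list for a stub of a child of the CONDITIONAL reduction route R2b1; analytic bricks OPEN; C4 OPEN; not a gap, not Clay.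
-/

set_option autoImplicit false

noncomputable section

open MeasureTheory Filter Topology Real
open scoped BigOperators
open Literature.MathematicalPhysics.QuantumFieldTheory
open Literature.MathematicalPhysics.QuantumLattice

namespace Summit.QuantumFields.YangMills.Theorems.FemtoTransferGap.TwoLattice.ConstTube

open Summit.QuantumFields.YangMills.Theorems.FemtoTransferGap
open Summit.QuantumFields.YangMills.Theorems.FemtoTransferGap.TwoLattice.Avg
open Summit.QuantumFields.YangMills.Theorems.FemtoTransferGap.TwoLattice.Stiff (LinkSpace)

variable {L : ℕ} [NeZero L]

/-! ## §1 One site: the orbit distance is the plain distance -/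

/-- On one site every gauge transformation is a single conjugation, so `gaugeDist g u = Σ_e ‖u_e − 1‖_F`. [folklore] -/
theorem gaugeDist_one_site (g : Site 3 1 → SU2) (u : GaugeConfig 3 1 SU2) :
    gaugeDist g u = ∑ e : Edge 3 1, frobNorm (((u e : SU2) : Matrix (Fin 2) (Fin 2) ℂ) - 1) := by
  unfold gaugeDist
  refine Finset.sum_congr rfl fun e _ => ?_
  have hg : g (e.1.shift e.2) = g e.1 := congrArg g (Subsingleton.elim _ _)
  show frobNorm ((((g e.1 * u e * (g (e.1.shift e.2))⁻¹ : SU2)) : Matrix (Fin 2) (Fin 2) ℂ) - 1) = _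
  rw [hg, frobNorm_conj_sub_one]

/-- ★ `orbitDist u = Σ_e ‖u_e − 1‖_F` at one site. [folklore] -/
theorem orbitDist_one_site_eq (u : GaugeConfig 3 1 SU2) : orbitDist u = ∑ e : Edge 3 1, frobNorm (((u e : SU2) : Matrix (Fin 2) (Fin 2) ℂ) - 1) := by
  unfold orbitDist
  have h : (Set.range fun g : Site 3 1 → SU2 => gaugeDist g u) = {∑ e : Edge 3 1, frobNorm (((u e : SU2) : Matrix (Fin 2) (Fin 2) ℂ) - 1)} := by
    ext x; simp only [Set.mem_range, Set.mem_singleton_iff, gaugeDist_one_site]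
    exact ⟨fun ⟨_, h⟩ => h.symm, fun h => ⟨fun _ => 1, h.symm⟩⟩
  rw [h, csInf_singleton]

/-- Each one-site link is within `orbitDist u` of `1`. [folklore] -/
theorem frobNorm_sub_one_le_orbitDist (u : GaugeConfig 3 1 SU2) (e : Edge 3 1) : frobNorm (((u e : SU2) : Matrix (Fin 2) (Fin 2) ℂ) - 1) ≤ orbitDist u := by
  rw [orbitDist_one_site_eq]
  exact Finset.single_le_sum (fun e' _ => frobNorm_nonneg (((u e' : SU2) : Matrix (Fin 2) (Fin 2) ℂ) - 1)) (Finset.mem_univ e)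

/-! ## §2 Links of a fibre point -/

omit [NeZero L] in
/-- `‖(orthoTube u v)_e − 1‖_F ≤ 4‖v_e‖ + ‖u_{dir e} − 1‖_F` for `‖v_e‖ ≤ 1/2`. [folklore] -/
theorem frobNorm_orthoTube_sub_one_le (u : GaugeConfig 3 1 SU2) {v : Edge 3 L → Fin 3 → ℝ} (e : Edge 3 L) (hv : ‖v e‖ ≤ 1 / 2) :
    frobNorm (((orthoTube L u v e : SU2) : Matrix (Fin 2) (Fin 2) ℂ) - 1) ≤ 4 * ‖v e‖ + frobNorm (((u (0, e.2) : SU2) : Matrix (Fin 2) (Fin 2) ℂ) - 1) := by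
  rw [orthoTube_apply]
  exact (frobNorm_mul_sub_one_le _ _).trans (by linarith [frobNorm_chartSU2_sub_one_le hv])

/-- `‖v_e‖ ≤ ‖linkEmbed v‖` (sup norm of a block against the Euclidean norm of the whole vector). [folklore] -/
theorem norm_apply_le_norm_linkEmbed (v : Edge 3 L → Fin 3 → ℝ) (e : Edge 3 L) : ‖v e‖ ≤ ‖linkEmbed L v‖ := by
  refine (pi_norm_le_iff_of_nonneg (norm_nonneg _)).mpr fun a => ?_
  have h := PiLp.norm_apply_le (linkEmbed L v) (e, a)
  rwa [linkEmbed_apply] at h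

omit [NeZero L] in
/-- ★ **Links of a fibre point are near `1`**: `orbitDist₁ u ≤ δ₁`, `‖v_e‖ ≤ r ≤ 1/2` ⇒ every link of `orthoTube u v` is within `4r + δ₁` of `1`. [folklore] -/
theorem frobNorm_orthoTube_sub_one_le' {u : GaugeConfig 3 1 SU2} {δ₁ : ℝ} (hu : orbitDist u ≤ δ₁) {v : Edge 3 L → Fin 3 → ℝ} {r : ℝ} (hr : r ≤ 1 / 2)
    (hv : ∀ e, ‖v e‖ ≤ r) (e : Edge 3 L) : frobNorm (((orthoTube L u v e : SU2) : Matrix (Fin 2) (Fin 2) ℂ) - 1) ≤ 4 * r + δ₁ := by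
  have h1 := frobNorm_orthoTube_sub_one_le u e ((hv e).trans hr)
  have h2 := (frobNorm_sub_one_le_orbitDist u (0, e.2)).trans hu
  linarith [hv e]

omit [NeZero L] in
/-- ★ Membership in `nearOne ρ`. [folklore] -/
theorem orthoTube_mem_nearOne {u : GaugeConfig 3 1 SU2} {δ₁ : ℝ} (hu : orbitDist u ≤ δ₁) {v : Edge 3 L → Fin 3 → ℝ} {r : ℝ} (hr : r ≤ 1 / 2) (hv : ∀ e, ‖v e‖ ≤ r)
    {ρ : ℝ} (hρ : 4 * r + δ₁ < ρ) : orthoTube L u v ∈ nearOne L ρ := fun e => (frobNorm_orthoTube_sub_one_le' hu hr hv e).trans_lt hρ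

/-- ★ **Orbit distance of a fibre point**: `orbitDist (orthoTube u v) ≤ |Edge|·(4r + δ₁)`. [folklore] -/
theorem orbitDist_orthoTube_le {u : GaugeConfig 3 1 SU2} {δ₁ : ℝ} (hu : orbitDist u ≤ δ₁) {v : Edge 3 L → Fin 3 → ℝ} {r : ℝ} (hr : r ≤ 1 / 2) (hv : ∀ e, ‖v e‖ ≤ r) :
    orbitDist (orthoTube L u v) ≤ Fintype.card (Edge 3 L) * (4 * r + δ₁) := by
  refine (orbitDist_le 1 _).trans ?_
  unfold gaugeDist
  rw [show gaugeTransform (1 : Site 3 L → SU2) (orthoTube L u v) = orthoTube L u v from TT.gaugeTransform_one' _]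
  calc ∑ e : Edge 3 L, frobNorm (((orthoTube L u v e : SU2) : Matrix (Fin 2) (Fin 2) ℂ) - 1) ≤ ∑ _e : Edge 3 L, (4 * r + δ₁) :=
        Finset.sum_le_sum fun e _ => frobNorm_orthoTube_sub_one_le' hu hr hv e
    _ = Fintype.card (Edge 3 L) * (4 * r + δ₁) := by rw [Finset.sum_const, nsmul_eq_mul, Finset.card_univ]

/-! ## §3 ★★ Fibres in the fat tube; supports of BO functions for the record weight -/

/-- ★★ **The fibre hypothesis of (B-N)**: over a slow point with `orbitDist₁ u ≤ δ₁`, every fibre point through the support of a profile `Ω ⊆ {‖x‖ ≤ r}` lies in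
`fatTubeRho δ' ρ β` once `4r + δ₁ < ρ β` and `|Edge|(4r + δ₁) < δ' β`. [folklore] -/
theorem orthoTube_mem_fatTubeRho {δ' ρ : ℝ → ℝ} {β : ℝ} {u : GaugeConfig 3 1 SU2} {δ₁ : ℝ} (hu : orbitDist u ≤ δ₁) {Ω : LinkSpace L → ℝ} {r : ℝ} (hr : r ≤ 1 / 2)
    (hΩ : ∀ x, Ω x ≠ 0 → ‖x‖ ≤ r) (hρ : 4 * r + δ₁ < ρ β) (hδ' : Fintype.card (Edge 3 L) * (4 * r + δ₁) < δ' β) (v : Edge 3 L → Fin 3 → ℝ)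
    (hv : Ω (linkEmbed L v) ≠ 0) : orthoTube L u v ∈ fatTubeRho L δ' ρ β := by
  have hve : ∀ e, ‖v e‖ ≤ r := fun e => (norm_apply_le_norm_linkEmbed v e).trans (hΩ _ hv)
  exact ⟨orthoTube_mem_nearOne hu hr hve hρ, (orbitDist_orthoTube_le hu hr hve).trans_lt hδ'⟩

/-- ★★ **`BOBricks.hbo` for the record weight**: a BO function with amplitude supported in `{orbitDist₁ < δ₁}` and profile in `{‖x‖ ≤ r}` is supported in
`supp (recordWeightRho δ' ρ δg β) ∩ {orbitDist < |Edge|(4r + δ₁)}`. [folklore] -/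
theorem boFun_support_record {δ' ρ δg : ℝ → ℝ} {β : ℝ} {φ : GaugeConfig 3 1 SU2 → ℝ} {δ₁ : ℝ} (hφ : ∀ u, φ u ≠ 0 → orbitDist u < δ₁)
    {Ω : LinkSpace L → ℝ} {r : ℝ} (hr : r ≤ 1 / 2) (hΩ : ∀ x, Ω x ≠ 0 → ‖x‖ ≤ r) (hρ : 4 * r + δ₁ < ρ β) (hδ' : Fintype.card (Edge 3 L) * (4 * r + δ₁) < δ' β)
    {U : GaugeConfig 3 L SU2} (hU : boFun L φ Ω U ≠ 0) :
    recordWeightRho L δ' ρ δg β U ≠ 0 ∧ orbitDist U < Fintype.card (Edge 3 L) * (4 * r + δ₁) := by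
  obtain ⟨hUt, hφU, hΩU⟩ := boFun_ne_zero L hU
  obtain ⟨u, v, hvc, rfl⟩ := hUt
  rw [slowMean_orthoTube L u hvc] at hφU
  rw [relLinkVec_orthoTube L u hvc] at hΩU
  have hu : orbitDist u ≤ δ₁ := (hφ u hφU).le
  have hve : ∀ e, ‖v e‖ ≤ r := fun e => (norm_apply_le_norm_linkEmbed v e).trans (hΩ _ hΩU)
  have hcard : (0 : ℝ) < Fintype.card (Edge 3 L) := by
    have : 0 < Fintype.card (Edge 3 L) := Fintype.card_pos_iff.mpr ⟨((fun _ => 0), 0)⟩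
    exact_mod_cast this
  have hr0 : 0 ≤ 4 * r + δ₁ := by
    have h1 := hve ((fun _ => 0), 0); have h2 := norm_nonneg (v ((fun _ => 0), 0)); have h3 := orbitDist_nonneg u; linarith
  refine ⟨?_, ?_⟩
  · have hmem : orthoTube L u v ∈ fatTubeRho L δ' ρ β := ⟨orthoTube_mem_nearOne hu hr hve hρ, (orbitDist_orthoTube_le hu hr hve).trans_lt hδ'⟩
    unfold recordWeightRho
    rw [Set.indicator_of_mem hmem, one_mul]
    exact (Real.exp_pos _).ne'
  · -- strict: shrink `δ₁` slightly using the strict amplitude bound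
    have hu' : orbitDist u < δ₁ := hφ u hφU
    obtain ⟨δ₀, hδ₀u, hδ₀⟩ := exists_between hu'
    calc orbitDist (orthoTube L u v) ≤ Fintype.card (Edge 3 L) * (4 * r + δ₀) := orbitDist_orthoTube_le hδ₀u.le hr hve
      _ < Fintype.card (Edge 3 L) * (4 * r + δ₁) := by nlinarith

end Summit.QuantumFields.YangMills.Theorems.FemtoTransferGap.TwoLattice.ConstTube

end
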